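import Literature.MathematicalPhysics.QuantumFieldTheory.Balaban1983to89.B6CubeWindowV1
import Literature.MathematicalPhysics.QuantumFieldTheory.Balaban1983to89.B6InMajorantTransplant

/-!
# `Balaban1983to89.B6CubeMemberBoundsV1` — T. Bałaban, *Propagators and renormalization transformations for lattice gauge theories. II*,
# Commun. Math. Phys. **96** (1984) 223–250 [Balaban1984PropagatorsII], (2.133)–(2.134) p. 247, (2.91)–(2.93) p. 239, p. 238 (T_□ = □̃³):
# THE TWO MEMBER-SIDE FACTS OF THE (2.134) CONSUMER THAT HOLD FOR THE MEMBERS OF `B6CubeWindowV1` AS CUT — the UNIFORM input-localised bound of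
# `G_□` for central inputs and ALL outputs, and the OUTPUT LOCALISATION of `G_□` to the blocks of its window (owner's finding F4, option A)

statement-level skeleton of published theorems with citation tags; proofs where landed; nothing here is a claim about the Yang–Mills mass gap

PDF held: `paper:balaban1984-cmp96-propagators-rt-ii` (journal page = PDF page + 222): p. 239 [PDF 17] ((2.91)–(2.93)), p. 247 [PDF 25] ((2.133)–(2.134)).

CITATION HEADER (lean-in-tree rule) — WHAT IS REPRODUCED.  Phase-2 file of the `lit-balaban` typed skeleton, seat **r03 gen 20**; SKELETON rows
**B6.Eq2.134** × **B6.Eq2.133** × B6.Prop2.6 (cells).  For the members `Gl` of `B6CubeWindowV1` (the conjugated scaled full-window transplants of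
the two-scale `G` of the cube's member `t(□)`):
* **`outLoc_Gl`** — `G_□` is OUTPUT-LOCALISED to `WT □` := the torus blocks met by the (translated) window bonds (`OutLoc (blkV1 hN D) (Gl …) (WT …)`);
  `mem_WT_iff`; every window bond's chart point is within `3L·S_j/2` of the cube centre (`B6CubeWindowV1.dist_le_of_deep`);
* **`inMajorant_Gl_bdd`** — THE UNIFORM BOUND: with the constant `A` of `B6InMajorantTransplant.inMajorant_GlV1_bdd` (on `d, L, a₀, a₁`),
  `InMajorant (blkV1 hN D) (Gl …) (Q^T_□) (fun _ y′ ↦ L^{d+1}·A·(L^{j(y′)}/c′)²)` — for inputs over the central reach `Q^T_□` and ALL outputs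
  (`s(□)⁻¹ = (L^{j₀}/c′)² ≤ (L^{j(y′)}/c′)²` on `Q^T_□`; chart frame by `inMajorant_GlV1_bdd`, global frame by `inMajorant_conj_chart`).
No `def` beyond the block set `WT`; no new fact; standard axioms.
HONEST SCOPE. (F4) No global-distance DECAY is claimed off the central reach — it is false at wrap-around outputs of a window member; print's (2.92)–(2.93)
read `G_□′` there only through the decaying `∂P∂*`-sandwich, where this uniform bound suffices; decay on `Q^T_□` is `B6CubeWindowV1.h2133_cube`.
Thresholds as in `B6CubeWindowV1` (`M_h = L^a ≥ 8`, `R ≥ 2L²`, placed cubes). NOT summit progress.  Unit `lit-balaban-r03` (gen 20), 2026-08-23.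
-/

noncomputable section

open scoped BigOperators
open Finset

namespace Literature.MathematicalPhysics.QuantumFieldTheory.Balaban1983to89.B6CubeMemberBoundsV1

open B4Reflection242 (boxDom)
open B6MultiLevelBoxOperator (N0 bigSide)
open B6MultiLevelTorusOperator (TDomains)
open B6Eq238MultiLevelTorus (svec)
open B6Cover236MultiLevelBlocks (cubes ctr Q)
open B6Geom246MultiLevelBox (bset toR)
open B6Geom246MultiLevelTorus (geomT blkMap)
open B6Partition118KLevelTorusCentral (Dch cc one_le_of_four_le)
open B6GlobalChartV1 (PV toBox domT blkV1 GlV1)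
open B6SectAOperatorsV1 (BondIdx)
open B6Prop26Gluing (OutLoc)
open B6RandomWalk (BlockSupp)
open B6AgreeLapV1Chart (cB DeepS mem_cB_W)
open B6TranslateV1 (tv)
open B6TranslateTorusV1 (vch TB outLoc_conj_chart)
open B6InMajorantTransplant (InMajorant inMajorant_smul inMajorant_mono inMajorant_conj_chart inMajorant_congr_set inMajorant_GlV1_bdd)
open B6Prop26KLevelSkeletonV1 (ST pref)
open B6CubeWindowV1

variable {d ℓ : ℕ} {hd : 1 ≤ d + 1} {hL : Odd (ℓ + 1) ∧ 1 < ℓ + 1} {a₀ a₁ : ℝ} {m K : ℕ} {Mh k R : ℕ} {P' : Fin (d + 1) → ℕ}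

variable (hN : ∀ μ, N0 ℓ Mh k P' μ = (PV d ℓ m K hd hL).sitesPerDir 0) {D : TDomains d ℓ Mh k P' R} (hk : k ≤ m + K)
  (hMh1 : 1 ≤ Mh) (hP4 : ∀ μ, 4 ≤ P' μ) {a : ℕ} (hMha : Mh = (ℓ + 1) ^ a) (c : ↥(cubes D.toDomains)) (ha : a₀ ≤ a₁)

/-! ## §1  Output localisation of `G_□` to the blocks of its window -/

/-- **THE TORUS BLOCKS MET BY THE WINDOW OF THE CUBE** (`T_□` read on `𝔅`): the block-map images of the chart blocks of the window bonds.
[cite: Balaban1984PropagatorsII, p.238 (T_□ = □̃³), (2.45) p.231, dictionary] -/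
def WT (hpl : Placed ℓ k P' c.1) (wc : BondIdx (domT hN (D.chart (svec ℓ k c.1.1 c.1.2)) hk) → ℝ) (cf : ℝ) : Set (geomT D).Site :=
  blkMap D (svec ℓ k c.1.1 c.1.2) ''
    {y | ∃ b ∈ (cB (tC hN hk hMh1 hP4 c ha a wc cf) (x0 ℓ Mh k c.1) (hx0 hpl) (hfit hN hMh1 hP4 hMha c ha hpl)).W,
      blkV1 hN (D.chart (svec ℓ k c.1.1 c.1.2)) b = y}

include hMha in
/-- every window bond's chart point lies within `3L·S_j/2` of the centre of the central cube. [cite: Balaban1984PropagatorsII, p.238, bookkeeping] -/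
theorem dist_le_of_mem_W (hpl : Placed ℓ k P' c.1) (wc : BondIdx (domT hN (D.chart (svec ℓ k c.1.1 c.1.2)) hk) → ℝ) (cf : ℝ)
    {b : PBond (PV d ℓ m K hd hL) 0} (hb : b ∈ (cB (tC hN hk hMh1 hP4 c ha a wc cf) (x0 ℓ Mh k c.1) (hx0 hpl) (hfit hN hMh1 hP4 hMha c ha hpl)).W) :
    dist (toR (toBox hN b.src).1) (ctr (Dch D c) (cc D hMh1 hP4 c)) ≤ 3 * ((ℓ : ℝ) + 1) * (bigSide ℓ Mh c.1.1 : ℝ) / 2 :=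
  dist_le_of_deep hN hMh1 hP4 hMha c (j0_hj hMh1 hP4 c a) ha ((mem_cB_W (hx₀ := hx0 hpl) (hfit := hfit hN hMh1 hP4 hMha c ha hpl)).1 hb)

/-- **`G_□` IS OUTPUT-LOCALISED TO THE BLOCKS OF ITS WINDOW** (the transplant vanishes off the window; conjugation translates the window).
[cite: Balaban1984PropagatorsII, (2.91)–(2.93) p.239, p.238 (T_□)] -/
theorem outLoc_Gl (hpl : Placed ℓ k P' c.1) (w : BondIdx (domT hN D hk) → ℝ) (cf : ℝ) :
    OutLoc (g := geomT D) (blkV1 hN D) (Gl hN hk hMh1 hP4 hMha c ha hpl w cf) (WT hN hk hMh1 hP4 hMha c ha hpl (wC hN hk c w) cf) := by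
  have hch : OutLoc (g := geomT (D.chart (svec ℓ k c.1.1 c.1.2))) (blkV1 hN (D.chart (svec ℓ k c.1.1 c.1.2)))
      (GlC hN hk hMh1 hP4 hMha c ha hpl (wC hN hk c w) cf)
      {y | ∃ b ∈ (cB (tC hN hk hMh1 hP4 c ha a (wC hN hk c w) cf) (x0 ℓ Mh k c.1) (hx0 hpl) (hfit hN hMh1 hP4 hMha c ha hpl)).W,
        blkV1 hN (D.chart (svec ℓ k c.1.1 c.1.2)) b = y} := by
    intro v x hx
    rw [GlC, LinearMap.smul_apply, Pi.smul_apply, smul_eq_mul]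
    unfold GlV1
    rw [B6Prop26ReachTransplant.transplant_apply]
    split_ifs with hxW
    · exact absurd (Set.mem_setOf_eq ▸ ⟨x, hxW, rfl⟩ : blkV1 hN (D.chart (svec ℓ k c.1.1 c.1.2)) x ∈
        {y | ∃ b ∈ (cB (tC hN hk hMh1 hP4 c ha a (wC hN hk c w) cf) (x0 ℓ Mh k c.1) (hx0 hpl) (hfit hN hMh1 hP4 hMha c ha hpl)).W,
          blkV1 hN (D.chart (svec ℓ k c.1.1 c.1.2)) b = y}) hx
    · rw [mul_zero]
  exact outLoc_conj_chart hN D hMh1 (one_le_of_four_le hP4) (svec ℓ k c.1.1 c.1.2) hch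

/-! ## §2  The uniform input-localised bound of `G_□` for central inputs -/

/-- **THE UNIFORM BOUND OF `G_□` FOR CENTRAL INPUTS AND ALL OUTPUTS**: with the constant `A` of `inMajorant_GlV1_bdd` (on `d, L, a₀, a₁`), for every
placed cube `|G_□ μ x| ≤ L^{d+1}·A·(L^{j(y′)}/c′)²·B` for `μ` over `y′ ∈ Q^T_□`, `|μ| ≤ B`, and EVERY `x` (`M_h ≥ 2`, `R ≥ 2L²`, `M_h = L^a`).
[cite: Balaban1984PropagatorsII, (2.133) p.247, (2.91)–(2.94) p.239, p.238] -/
theorem inMajorant_Gl_bdd (d ℓ : ℕ) (hd : 1 ≤ d + 1) (hL : Odd (ℓ + 1) ∧ 1 < ℓ + 1) {a₀ a₁ : ℝ} (ha₀ : 0 < a₀) (ha₁ : a₀ ≤ a₁) :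
    ∃ A : ℝ, 0 ≤ A ∧ ∀ (m K : ℕ) {Mh k R : ℕ} {P' : Fin (d + 1) → ℕ}
      (hN : ∀ μ, N0 ℓ Mh k P' μ = (PV d ℓ m K hd hL).sitesPerDir 0) (D : TDomains d ℓ Mh k P' R) (hk : k ≤ m + K)
      (hMh1 : 1 ≤ Mh) (hP4 : ∀ μ, 4 ≤ P' μ) (_ : 2 ≤ Mh) {a : ℕ} (hMha : Mh = (ℓ + 1) ^ a) (_ : 2 * (ℓ + 1) ^ 2 ≤ R)
      (c : ↥(cubes D.toDomains)) (hpl : Placed ℓ k P' c.1) (w : BondIdx (domT hN D hk) → ℝ) (cf : ℝ),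
      InMajorant (g := geomT D) (blkV1 hN D) (Gl hN hk hMh1 hP4 hMha c ha₁ hpl w cf) (ST D hMh1 hP4 c)
        (fun _ y' => ((ℓ + 1) ^ (d + 1) : ℕ) * A * pref cf y') := by
  obtain ⟨A, hA, h⟩ := inMajorant_GlV1_bdd d ℓ hd hL ha₀ ha₁
  refine ⟨A, hA, fun m K Mh k R P' hN D hk hMh1 hP4 hMh a hMha hR2 c hpl w cf => ?_⟩
  have hP : ∀ μ, 1 ≤ P' μ := one_le_of_four_le hP4
  have hR : 2 * (ℓ + 1) ≤ R := le_trans (by nlinarith : 2 * (ℓ + 1) ≤ 2 * (ℓ + 1) ^ 2) hR2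
  -- chart frame: the uniform bound of the full-window transplant over the central reach
  have hch := h (tC hN hk hMh1 hP4 c ha₁ a (wC hN hk c w) cf) m K hN (D.chart (svec ℓ k c.1.1 c.1.2)) (x0 ℓ Mh k c.1) (hx0 hpl)
    (hfit hN hMh1 hP4 hMha c ha₁ hpl)
    (fun μ => pow_dvd_x0 ℓ Mh k c.1 (by have := jmin_le_level hMh1 hP4 c; show j0 hMh1 hP4 c ≤ c.1.1 + 1; unfold j0; omega) μ)
    ((ℓ + 1) ^ eC a c.1.1) (by show (ℓ + 1) ^ eC a c.1.1 ≤ (ℓ + 1) ^ (eC a c.1.1 + 0); simp)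
    (hlev_window hMh1 hP4 hMha c hL hR2) (SQ hMh1 hP4 c) (fun b hb => inWindow_of_blk_mem_Q hN hMh1 hP4 hMha c hMh hR b hb)
  -- scale by `s(□)⁻¹ ≤ pref` on the reach, conjugate, carry the reach set
  have hsc := inMajorant_smul _ hch (sc hMh1 hP4 c cf)⁻¹
  have hmono : InMajorant (g := geomT (D.chart (svec ℓ k c.1.1 c.1.2))) (blkV1 hN (D.chart (svec ℓ k c.1.1 c.1.2)))
      (GlC hN hk hMh1 hP4 hMha c ha₁ hpl (wC hN hk c w) cf) (SQ hMh1 hP4 c) (fun _ y' => ((ℓ + 1) ^ (d + 1) : ℕ) * A * pref cf y') := by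
    refine inMajorant_mono _ hsc fun y y' hy' => ?_
    have hlev := j0_le_of_mem_Q hMh1 hP4 c hMh hR2 hL ((mem_SQ hMh1 hP4 c y').1 hy')
    rw [sc_inv, abs_of_nonneg (sq_nonneg _)]
    have hL1 : (1 : ℝ) ≤ ((ℓ + 1 : ℕ) : ℝ) := by exact_mod_cast Nat.succ_pos ℓ
    have hpow : (((ℓ + 1 : ℕ) : ℝ)) ^ j0 hMh1 hP4 c ≤ (((ℓ + 1 : ℕ) : ℝ)) ^ y'.1.1 := pow_le_pow_right₀ hL1 hlev
    have hsq : ((((ℓ + 1 : ℕ) : ℝ)) ^ j0 hMh1 hP4 c / cf) ^ 2 ≤ pref cf y' := by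
      unfold pref
      rw [div_pow, div_pow]
      by_cases hcf : cf = 0
      · simp [hcf]
      · exact div_le_div_of_nonneg_right (pow_le_pow_left₀ (by positivity) hpow 2) (by positivity)
    have hC : (0 : ℝ) ≤ ((ℓ + 1) ^ (d + 1) : ℕ) * A := by positivity
    calc ((((ℓ + 1 : ℕ) : ℝ)) ^ j0 hMh1 hP4 c / cf) ^ 2 * ((((ℓ + 1) ^ (d + 1) : ℕ) : ℝ) * A)
        = (((ℓ + 1) ^ (d + 1) : ℕ) : ℝ) * A * ((((ℓ + 1 : ℕ) : ℝ)) ^ j0 hMh1 hP4 c / cf) ^ 2 := by ring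
      _ ≤ (((ℓ + 1) ^ (d + 1) : ℕ) : ℝ) * A * pref cf y' := mul_le_mul_of_nonneg_left hsq hC
  have hg := inMajorant_conj_chart hN D hMh1 hP (svec ℓ k c.1.1 c.1.2) (K' := fun _ y' => ((ℓ + 1) ^ (d + 1) : ℕ) * A * pref cf y') hmono
    (fun a b => by rw [show pref cf (blkMap D (svec ℓ k c.1.1 c.1.2) b) = pref cf b by
      unfold pref; rw [B6TranslateTorusV1.blkMap_fst D hMh1 hP]])
  exact inMajorant_congr_set _ (mem_blkMap_image_SQ hMh1 hP4 c) hg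

end Literature.MathematicalPhysics.QuantumFieldTheory.Balaban1983to89.B6CubeMemberBoundsV1

end
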